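import Summits.CriticalPhenomena.PercolationContinuityZ3.Theorems.Transplant.BccClawXTableOKA
import Summits.CriticalPhenomena.PercolationContinuityZ3.Theorems.Transplant.BccClawXTableOKB
import Summits.CriticalPhenomena.PercolationContinuityZ3.Theorems.Transplant.BccClawXTableOKC
import Summits.CriticalPhenomena.PercolationContinuityZ3.Theorems.Transplant.BccClawXTableOKD
import Summits.CriticalPhenomena.PercolationContinuityZ3.Theorems.Transplant.BccClawXSound
import HarnessLib

/-!
# The bcc (001)-slabs, exit-form routing certificate IV: THE PLANAR CLAW EXISTS for every column-certified, non-exceptional terminal triple of every block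
# pair (the 28 kernel theorems + the diagonal mirror), and the bridge from the tree's columns (`Site 2`, «BccSlabClearedSetX») to the model

builds on p205010 (kernel theorem, internal audit signed; external expert review pending) — NOT used in this file.
Lane `prim-bschramm`, seat `prim-bschramm-p2` (gen 46; class C1b, METHOD = input substitution; memo `HOME/bschramm/P2-LATTICES.md` §156); helper file
(`--supports stmt-CriticalPhenomena-4575 --as helper`).
* §1 `clawXOK_three` (the `28` classes with `t_R = 3` from «BccClawXTableOK{A,B,C,D}»), **`exists_claw`** (every clip class: mirror for `t_R < 3`);
* §2 the bridge: relative columns `rel z w` / `pt z p`, `adjb_iff` (lattice adjacency), `inDp_rel_iff` (= `BccSlab.Dcols`), `inRPp_rel_iff`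
  (= `Dcols ∩ sqBlkR 3 z t_R s_R`), `isTgt_rel` / `mem_tgtRList` / `mem_tgtList` (the tree's target columns `BccSlab.tgtCols` are target columns of the
  model, with class codes `(min t_R 3, min t_D 4, min s_R 3, min s_D 4)`), and **`exists_claw_of_tgtCols`** — the planar input of the 3D template
  «BccSlabHubRoute» in the form «BccSlabClearedSetX».`ColRouting` asks for.
[cite: DuminilCopinSidoraviciusTassion2016, §2.3 (proof of Fact 2: the three disjoint paths in B̄_R(z))]
-/

namespace Summit.CriticalPhenomena.PercolationContinuityZ3.Theorems.Transplant

namespace BccClawX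

open Literature.Probability.Percolation Literature.Probability.LatticeModels SimpleGraph
open BccSlab (Dcols cornerCols extCols tgtCols mem_Dcols mem_cornerCols mem_extCols mem_tgtCols mem_sqBlkR_three_iff_linear)

/-! ## §1 The rule succeeds on every clip class (the 28 kernel theorems and their mirror images) -/

/-- **The rule succeeds for every clip class with `t_R = 3`** (`t_D ∈ {3,4}`, `s_R ≤ 3`, `s_R ≤ s_D ≤ 4`; the `28` kernel theorems of
«BccClawXTableOK{A,B,C,D}»). [folklore] -/
theorem clawXOK_three {cD cS cE : ℕ} (hD : 3 ≤ cD) (hD' : cD ≤ 4) (hS : cS ≤ 3) (hE : cE ≤ 4) (hSE : cS ≤ cE) : ClawXOK 3 cD cS cE := by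
  interval_cases cD <;> interval_cases cS <;> interval_cases cE
  all_goals first
    | exact clawXOK_3300 | exact clawXOK_3301 | exact clawXOK_3302 | exact clawXOK_3303 | exact clawXOK_3304
    | exact clawXOK_3311 | exact clawXOK_3312 | exact clawXOK_3313 | exact clawXOK_3314
    | exact clawXOK_3322 | exact clawXOK_3323 | exact clawXOK_3324 | exact clawXOK_3333 | exact clawXOK_3334
    | exact clawXOK_3400 | exact clawXOK_3401 | exact clawXOK_3402 | exact clawXOK_3403 | exact clawXOK_3404
    | exact clawXOK_3411 | exact clawXOK_3412 | exact clawXOK_3413 | exact clawXOK_3414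
    | exact clawXOK_3422 | exact clawXOK_3423 | exact clawXOK_3424 | exact clawXOK_3433 | exact clawXOK_3434

/-- The `49` columns of `sqBall 0 3` have coordinates in `[-3, 3]` (kernel computation on the list). [folklore] -/
theorem allPts_bounds : ∀ p ∈ allPts, -3 ≤ p.1 ∧ p.1 ≤ 3 ∧ -3 ≤ p.2 ∧ p.2 ≤ 3 := by decide

/-- Membership in the list of the `49` columns of `sqBall 0 3`. [folklore] -/
theorem mem_allPts_iff {p : Pt} : p ∈ allPts ↔ -3 ≤ p.1 ∧ p.1 ≤ 3 ∧ -3 ≤ p.2 ∧ p.2 ≤ 3 := by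
  constructor
  · exact allPts_bounds p
  · rintro ⟨h1, h2, h3, h4⟩
    obtain ⟨x, y⟩ := p
    simp only at h1 h2 h3 h4
    interval_cases x <;> interval_cases y <;> decide

/-- `allPts` is mirror-invariant. [folklore] -/
theorem sw_mem_allPts {p : Pt} (h : p ∈ allPts) : sw p ∈ allPts := by
  rw [mem_allPts_iff] at h ⊢; simp only [sw]; omega

/-- **THE CLAW EXISTS for every admissible configuration of every clip class** (codes `c_R ≤ 3`, `c_D ≤ 4`, `c_S ≤ 3`, `c_E ≤ 4`, `c_R ≤ c_D`, `c_S ≤ c_E`,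
`c_R = 3 ∨ c_S = 3`): directly from the kernel theorems when `c_R = 3`, through the diagonal mirror («BccClawXSound» §2) when `c_R < 3`.
[cite: DuminilCopinSidoraviciusTassion2016, §2.3 (proof of Fact 2: the three disjoint paths)] -/
theorem exists_claw {cR cD cS cE : ℕ} (hR : cR ≤ 3) (hD : cD ≤ 4) (hS : cS ≤ 3) (hE : cE ≤ 4) (hRD : cR ≤ cD) (hSE : cS ≤ cE) (hone : cR = 3 ∨ cS = 3)
    {a1 a2 a3 : Pt} (h1 : a1 ∈ tgtRList cR cD cS cE) (h2 : a2 ∈ tgtRList cR cD cS cE) (h3 : a3 ∈ tgtList cD cE)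
    (hadm : admissible cR cD cS cE a1 a2 a3 = true) : ∃ (q : Pt) (l1 l2 l3 : List Pt), ClawProps cR cD cS cE a1 a2 a3 q l1 l2 l3 := by
  by_cases h3R : cR = 3
  · subst h3R
    have := clawXOK_three hRD hD hS hE hSE a1 h1 a2 h2 a3 h3 hadm
    obtain ⟨⟨q, l1, l2, l3⟩, hsome⟩ := Option.isSome_iff_exists.1 this
    exact ⟨q, l1, l2, l3, clawX_sound hsome⟩
  · have hS3 : cS = 3 := hone.resolve_left h3R
    subst hS3
    rw [tgtRList, List.mem_filter] at h1 h2
    rw [tgtList, List.mem_filter] at h3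
    have h1' : sw a1 ∈ tgtRList 3 cE cR cD := by
      rw [tgtRList, List.mem_filter, isTgtR_sw]; exact ⟨sw_mem_allPts h1.1, h1.2⟩
    have h2' : sw a2 ∈ tgtRList 3 cE cR cD := by
      rw [tgtRList, List.mem_filter, isTgtR_sw]; exact ⟨sw_mem_allPts h2.1, h2.2⟩
    have h3' : sw a3 ∈ tgtList cE cD := by
      rw [tgtList, List.mem_filter, Bool.and_eq_true, isTgt_sw, sw_beq_zero]; exact ⟨sw_mem_allPts h3.1, by simpa using h3.2⟩
    have hadm' : admissible 3 cE cR cD (sw a1) (sw a2) (sw a3) = true := by rw [admissible_sw]; exact hadm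
    have := clawXOK_three hSE hE hR hD hRD (sw a1) h1' (sw a2) h2' (sw a3) h3' hadm'
    obtain ⟨⟨q, l1, l2, l3⟩, hsome⟩ := Option.isSome_iff_exists.1 this
    exact ⟨sw q, l1.map sw, l2.map sw, l3.map sw, (clawX_sound hsome).unsw⟩

/-! ## §2 The bridge to `Site 2`: relative columns, regions, target columns -/

/-- The column of `Site 2` at relative position `p` from `z`. [folklore] -/
def pt (z : Site 2) (p : Pt) : Site 2 := ![z 0 + p.1, z 1 + p.2]

/-- The relative position of a column. [folklore] -/
def rel (z w : Site 2) : Pt := (w 0 - z 0, w 1 - z 1)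

/-- Coordinates of `pt`. [folklore] -/
@[simp] theorem pt_apply_zero (z : Site 2) (p : Pt) : pt z p 0 = z 0 + p.1 := rfl

/-- Coordinates of `pt`. [folklore] -/
@[simp] theorem pt_apply_one (z : Site 2) (p : Pt) : pt z p 1 = z 1 + p.2 := rfl

/-- `pt ∘ rel = id`. [folklore] -/
@[simp] theorem pt_rel (z w : Site 2) : pt z (rel z w) = w := by
  ext i; fin_cases i <;> simp [pt, rel]

/-- `rel ∘ pt = id`. [folklore] -/
@[simp] theorem rel_pt (z : Site 2) (p : Pt) : rel z (pt z p) = p := by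
  obtain ⟨x, y⟩ := p; simp [rel, pt]

/-- `pt z` is injective. [folklore] -/
theorem pt_injective (z : Site 2) : Function.Injective (pt z) := fun p q h => by rw [← rel_pt z p, h, rel_pt]

/-- **`adjb` is lattice adjacency of `ℤ²`.** [folklore] -/
theorem adjb_iff {z : Site 2} {a b : Pt} : adjb a b = true ↔ (zdGraph 2).Adj (pt z a) (pt z b) := by
  rw [zdGraph_adj_iff]
  simp only [adjb, Bool.or_eq_true, Bool.and_eq_true, decide_eq_true_eq]
  constructor
  · rintro (⟨h1, h2 | h2⟩ | ⟨h1, h2 | h2⟩)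
    · exact ⟨1, Or.inr (by ext i; fin_cases i <;> simp [h1, h2]; omega)⟩
    · exact ⟨1, Or.inl (by ext i; fin_cases i <;> simp [h1, h2]; omega)⟩
    · exact ⟨0, Or.inr (by ext i; fin_cases i <;> simp [h1, h2]; omega)⟩
    · exact ⟨0, Or.inl (by ext i; fin_cases i <;> simp [h1, h2]; omega)⟩
  · rintro ⟨i, h | h⟩
    · have c0 := congrFun h 0; have c1 := congrFun h 1
      fin_cases i <;> simp at c0 c1 <;> omega
    · have c0 := congrFun h 0; have c1 := congrFun h 1
      fin_cases i <;> simp at c0 c1 <;> omega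

/-- Relative positions of lattice neighbours. [folklore] -/
theorem adjb_rel {z v w : Site 2} (h : (zdGraph 2).Adj v w) : adjb (rel z v) (rel z w) = true := by
  rw [adjb_iff (z := z), pt_rel, pt_rel]; exact h

/-- The block of the model is the clipped block. [folklore] -/
theorem inD_rel_iff {z : Site 2} {tD sD : ℕ} {w : Site 2} : inD (min tD 4) (min sD 4) (rel z w) = true ↔ w ∈ sqBlkR 3 z tD sD := by
  rw [mem_sqBlkR_three_iff_linear]
  simp only [inD, rel, Bool.and_eq_true, decide_eq_true_eq, Nat.cast_min, Nat.cast_ofNat]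
  have ht := min_le_left (tD : ℤ) 4
  have hs := min_le_left (sD : ℤ) 4
  constructor
  · rintro ⟨⟨⟨⟨⟨h1, h2⟩, h3⟩, h4⟩, h5⟩, h6⟩
    exact ⟨⟨by omega, by omega, by omega, by omega⟩, by omega, by omega⟩
  · rintro ⟨⟨h1, h2, h3, h4⟩, h5, h6⟩
    exact ⟨⟨⟨⟨⟨by omega, by omega⟩, le_min (by omega) (by omega)⟩, by omega⟩, by omega⟩, le_min (by omega) (by omega)⟩

/-- The corners of the model are the corner columns. [folklore] -/
theorem isCorner_rel_iff {z : Site 2} {tD sD : ℕ} {w : Site 2} : isCorner (min tD 4) (min sD 4) (rel z w) = true ↔ w ∈ cornerCols z tD sD := by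
  rw [mem_cornerCols]
  have hmt : min (min (tD : ℤ) 4) 3 = min (tD : ℤ) 3 := by rw [min_assoc, min_eq_right (by norm_num : (3 : ℤ) ≤ 4)]
  have hms : min (min (sD : ℤ) 4) 3 = min (sD : ℤ) 3 := by rw [min_assoc, min_eq_right (by norm_num : (3 : ℤ) ≤ 4)]
  simp only [isCorner, rel, Bool.and_eq_true, Bool.or_eq_true, beq_iff_eq, Nat.cast_min, Nat.cast_ofNat]
  rw [hmt, hms]
  constructor <;> rintro ⟨h1, h2⟩ <;> constructor <;> omega

/-- **The cleared region of the model is the cleared column set.** [folklore] -/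
theorem inDp_rel_iff {z : Site 2} {tD sD : ℕ} {w : Site 2} : inDp (min tD 4) (min sD 4) (rel z w) = true ↔ w ∈ Dcols z tD sD := by
  rw [mem_Dcols, ← inD_rel_iff, ← isCorner_rel_iff, inDp, Bool.and_eq_true, Bool.not_eq_true', Bool.eq_false_iff]

/-- **The rerouting region of the model is the cleared column set inside the rerouting block.** [folklore] -/
theorem inRPp_rel_iff {z : Site 2} {tR tD sR sD : ℕ} {w : Site 2} :
    inRPp (min tR 3) (min tD 4) (min sR 3) (min sD 4) (rel z w) = true ↔ w ∈ Dcols z tD sD ∧ w ∈ sqBlkR 3 z tR sR := by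
  rw [inRPp, Bool.and_eq_true, Bool.and_eq_true, inDp_rel_iff, mem_sqBlkR_three_iff_linear]
  simp only [rel, decide_eq_true_eq, Nat.cast_min, Nat.cast_ofNat]
  have ht := min_le_left (tR : ℤ) 3
  have hs := min_le_left (sR : ℤ) 3
  constructor
  · rintro ⟨⟨hD, h1⟩, h2⟩
    obtain ⟨⟨b1, b2, b3, b4⟩, -, -⟩ := mem_sqBlkR_three_iff_linear.1 (mem_Dcols.1 hD).1
    exact ⟨hD, ⟨b1, b2, b3, b4⟩, by omega, by omega⟩
  · rintro ⟨hD, ⟨b1, b2, b3, b4⟩, h5, h6⟩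
    exact ⟨⟨hD, le_min (by omega) (by omega)⟩, le_min (by omega) (by omega)⟩

/-- An exterior column of the tree is exterior in the model (for columns next to the block). [folklore] -/
theorem isExt_rel {z : Site 2} {tD sD : ℕ} {w q : Site 2} (hw : w ∈ Dcols z tD sD) (hadj : (zdGraph 2).Adj w q) (hq : q ∈ extCols z tD sD) :
    isExt (min tD 4) (min sD 4) (rel z q) = true := by
  obtain ⟨⟨hq0, hq1⟩, hqD⟩ := hq
  rw [isExt, Bool.and_eq_true, inBigWin, Bool.and_eq_true, decide_eq_true_eq, decide_eq_true_eq]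
  refine ⟨⟨?_, ?_⟩, ?_⟩
  · have hw' := (mem_sqBlkR_three_iff_linear.1 hw.1).1
    have h4 : q 0 - z 0 ≤ 4 := by
      rcases (zdGraph_adj_iff _ _).1 hadj with ⟨i, h | h⟩ <;> have c0 := congrFun h 0 <;> fin_cases i <;> simp at c0 <;> omega
    simp only [rel, Nat.cast_min, Nat.cast_ofNat]; exact le_min (by omega) h4
  · have hw' := (mem_sqBlkR_three_iff_linear.1 hw.1).1
    have h4 : q 1 - z 1 ≤ 4 := by
      rcases (zdGraph_adj_iff _ _).1 hadj with ⟨i, h | h⟩ <;> have c1 := congrFun h 1 <;> fin_cases i <;> simp at c1 <;> omega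
    simp only [rel, Nat.cast_min, Nat.cast_ofNat]; exact le_min (by omega) h4
  · simpa [Bool.not_eq_true'] using (show ¬ (inDp (min tD 4) (min sD 4) (rel z q) = true) from fun h => hqD (inDp_rel_iff.1 h))

/-- **A target column of the tree is a target column of the model.** [folklore] -/
theorem isTgt_rel {z : Site 2} {tD sD : ℕ} {w : Site 2} (hw : w ∈ tgtCols z tD sD) : isTgt (min tD 4) (min sD 4) (rel z w) = true := by
  obtain ⟨hwD, q, hadj, hq⟩ := hw
  rw [isTgt, Bool.and_eq_true, inDp_rel_iff, List.any_eq_true]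
  refine ⟨hwD, rel z q, ?_, isExt_rel hwD hadj hq⟩
  have ha := adjb_rel (z := z) hadj
  simp only [adjb, Bool.or_eq_true, Bool.and_eq_true, decide_eq_true_eq] at ha
  simp only [nbrs, List.mem_cons, List.not_mem_nil, or_false, Prod.ext_iff]
  omega

/-- **A target column of the rerouting block other than the centre, in the model.** [folklore] -/
theorem mem_tgtRList {z : Site 2} {tR tD sR sD : ℕ} {w : Site 2} (hw : w ∈ tgtCols z tD sD) (hR : w ∈ sqBlkR 3 z tR sR) (hz : w ≠ z) :
    rel z w ∈ tgtRList (min tR 3) (min tD 4) (min sR 3) (min sD 4) := by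
  rw [tgtRList, List.mem_filter, isTgtR, Bool.and_eq_true, Bool.and_eq_true, Bool.and_eq_true, isTgt_rel hw, mem_allPts_iff]
  have hB := (mem_sqBlkR_three_iff_linear.1 hR)
  obtain ⟨⟨b1, b2, b3, b4⟩, b5, b6⟩ := hB
  simp only [rel, decide_eq_true_eq, Nat.cast_min, Nat.cast_ofNat, Bool.not_eq_true', beq_eq_false_iff_ne, ne_eq, Prod.mk.injEq, true_and]
  refine ⟨⟨by omega, by omega, by omega, by omega⟩, ⟨le_min (by omega) (by omega), le_min (by omega) (by omega)⟩, fun h => hz ?_⟩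
  ext i; fin_cases i
  · show w 0 = z 0; omega
  · show w 1 = z 1; omega

/-- **A target column other than the centre, in the model.** [folklore] -/
theorem mem_tgtList {z : Site 2} {tD sD : ℕ} {w : Site 2} (hw : w ∈ tgtCols z tD sD) (hz : w ≠ z) : rel z w ∈ tgtList (min tD 4) (min sD 4) := by
  rw [tgtList, List.mem_filter, Bool.and_eq_true, isTgt_rel hw, mem_allPts_iff]
  have hB := (mem_sqBlkR_three_iff_linear.1 hw.1.1)
  obtain ⟨⟨b1, b2, b3, b4⟩, -, -⟩ := hB
  simp only [rel, Bool.not_eq_true', beq_eq_false_iff_ne, ne_eq, Prod.mk.injEq, true_and]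
  refine ⟨⟨by omega, by omega, by omega, by omega⟩, fun h => hz ?_⟩
  ext i; fin_cases i
  · show w 0 = z 0; omega
  · show w 1 = z 1; omega

/-- The class codes of raw block parameters satisfy the hypotheses of `exists_claw`. [folklore] -/
theorem codes_ok {tR tD sR sD : ℕ} (hRD : tR ≤ tD) (hSE : sR ≤ sD) (hone : 3 ≤ tR ∨ 3 ≤ sR) :
    min tR 3 ≤ 3 ∧ min tD 4 ≤ 4 ∧ min sR 3 ≤ 3 ∧ min sD 4 ≤ 4 ∧ min tR 3 ≤ min tD 4 ∧ min sR 3 ≤ min sD 4 ∧ (min tR 3 = 3 ∨ min sR 3 = 3) := by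
  refine ⟨min_le_right _ _, min_le_right _ _, min_le_right _ _, min_le_right _ _, ?_, ?_, ?_⟩
  · exact le_min ((min_le_left _ _).trans hRD) ((min_le_right _ _).trans (by norm_num))
  · exact le_min ((min_le_left _ _).trans hSE) ((min_le_right _ _).trans (by norm_num))
  · exact hone.imp (fun h => min_eq_right h) (fun h => min_eq_right h)

/-- **THE PLANAR CLAW for a column-certified, non-exceptional triple** (tree form of the hypotheses, model form of the conclusion, relative to `z`).
[cite: DuminilCopinSidoraviciusTassion2016, §2.3 (proof of Fact 2: the three disjoint paths in B̄_R(z))] -/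
theorem exists_claw_of_tgtCols {z : Site 2} {tR tD sR sD : ℕ} (hRD : tR ≤ tD) (hSE : sR ≤ sD) (hone : 3 ≤ tR ∨ 3 ≤ sR) {a₁ a₂ a₃ : Site 2}
    (h1 : a₁ ∈ tgtCols z tD sD) (h1R : a₁ ∈ sqBlkR 3 z tR sR) (h1z : a₁ ≠ z) (h2 : a₂ ∈ tgtCols z tD sD) (h2R : a₂ ∈ sqBlkR 3 z tR sR) (h2z : a₂ ≠ z)
    (h3 : a₃ ∈ tgtCols z tD sD) (h3z : a₃ ≠ z) (h31 : a₃ ≠ a₁) (h32 : a₃ ≠ a₂)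
    (hexc : stackedExc (min tR 3) (min tD 4) (min sR 3) (min sD 4) (rel z a₁) (rel z a₂) (rel z a₃) = false) :
    ∃ (q : Pt) (l1 l2 l3 : List Pt), ClawProps (min tR 3) (min tD 4) (min sR 3) (min sD 4) (rel z a₁) (rel z a₂) (rel z a₃) q l1 l2 l3 := by
  obtain ⟨cR, cD, cS, cE, cRD, cSE, cone⟩ := codes_ok hRD hSE hone
  refine exists_claw cR cD cS cE cRD cSE cone (mem_tgtRList h1 h1R h1z) (mem_tgtRList h2 h2R h2z) (mem_tgtList h3 h3z) ?_
  have hne1 : rel z a₃ ≠ rel z a₁ := fun h => h31 (by rw [← pt_rel z a₃, h, pt_rel])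
  have hne2 : rel z a₃ ≠ rel z a₂ := fun h => h32 (by rw [← pt_rel z a₃, h, pt_rel])
  simp only [admissible, Bool.and_eq_true, Bool.not_eq_true', beq_eq_false_iff_ne, ne_eq, hexc]
  exact ⟨⟨hne1, hne2⟩, trivial⟩

end BccClawX

end Summit.CriticalPhenomena.PercolationContinuityZ3.Theorems.Transplant
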